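import Summits.BirchSwinnertonDyer.BirchSwinnertonDyer.Theorems.CMKolyvaginAtInertTwoShaCountHabitatAtTwo
import Summits.BirchSwinnertonDyer.BirchSwinnertonDyer.Theorems.CMKolyvaginAtInertTwoShaCountTwistModelAtTwo
import Literature.NumberTheory.QuadraticFields.KroneckerSplitting
import HarnessLib

/-!
# Route `CMKolyvaginAtInertTwo`, crux `CMKolyvaginExactAtInertTwo` (stmt-BirchSwinnertonDyer-24277):
# THE COUNT IDENTITY `#Ш(E/K)[2^∞] = #Ш(E/ℚ)[2^∞] · #Ш(E^{(d_K)}/ℚ)[2^∞]`, VII — the ramified prime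
# of a prime Heegner field is INERT in the CM field (`CMInert W |d_K|` from the crux's own binders),
# and the count identity on H₂ with that binder discharged

Seat `bsd-line-cmk2-p1` g15 (cell `bsd-print-cf2`); helper (`--supports stmt-BirchSwinnertonDyer-24277`).
THEOREMS ONLY: no definition, no named fact, no `sorry`; Milne's Weil-restriction theorem stays a
HYPOTHESIS; no item is closed; BSD is not proved by this.

File V left ONE habitat binder undischarged: `CMInert W q` for the ramified prime `q = |d_K|`. It
follows from the crux's hypotheses (CM, `CMInert W 2`, `ρ̄_{E,2}` onto, `W` globally minimal; `K`
imaginary quadratic, `d_K` odd with `|d_K| = q` prime; Heegner hypothesis for `N`) by quadratic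
reciprocity: with `d_F = −ℓ ∈ {−3, −11, −19, −43, −67, −163}` and `Δ_min = d_F·s²`
(`exists_Δ_eq_cmFieldDiscr_mul_sq_of_cmInert_two`), `ℓ ∣ Δ_min`, so `W` is bad at `ℓ`, `ℓ ∣ N`, and
the Heegner hypothesis makes `ℓ` SPLIT in `K`: `(d_K/ℓ) = 1` (decomposition law,
`Quadratic.ncard_primesOver_eq_two_iff_legendreSym`). Hence `q ≠ ℓ` (`q ∣ d_K`), i.e. `q ∤ d_F`
(`¬CMRamified`); and if `d_F` were a square mod `q` then `(−ℓ/q) = 1 = (−q/ℓ)` with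
`q ≡ ℓ ≡ 3 (mod 4)` would give `(ℓ/q) = (q/ℓ) = −1`, contradicting reciprocity
`(ℓ/q) = −(q/ℓ)` (`legendreSym.quadratic_reciprocity_three_mod_four`); so `¬CMSplit`.

* `prime_natAbs_cmFieldDiscr_of_cmInert_two` — `ℓ = |d_F|` is a prime `≡ 3 (mod 4)`, `d_F = −ℓ`;
* `natAbs_cmFieldDiscr_dvd_minimalDiscriminantInt` — `ℓ ∣ Δ_min` on H₂;
* `natAbs_cmFieldDiscr_dvd_conductorNorm` — `ℓ ∣ N` (the CM prime is bad);
* `cmInert_natAbs_discr_of_heegner` — **`CMInert W |d_K|`** on H₂ for a prime Heegner field;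
* `card_primaryComponent_sha_two_baseChange_eq_mul_of_heegner_prime_of_milne` — **the count
  identity on H₂ with prime `|d_K|`, all habitat binders discharged** (modulo Milne, total rank one,
  finiteness of `Ш(E)`, `Ш(E_d)`).

References: Gross 1991 §§2–3; Cox, *Primes of the form x² + ny²*, Prop. 5.16; Ireland–Rosen
Prop. 13.1.3 and Thm. 5.1 (reciprocity); Silverman *ATAEC* App. A §3.
-/

-- single-conjunct summit: `Summit.BirchSwinnertonDyer.BirchSwinnertonDyer.…` repeats the name by design
set_option linter.dupNamespace false
set_option autoImplicit false

noncomputable section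

open scoped Classical

open WeierstrassCurve NumberField Literature.NumberTheory.EllipticCurves
  Literature.NumberTheory.EllipticCurves.Rank1Residual Literature.NumberTheory.QuadraticFields
  Summit.BirchSwinnertonDyer.Rank1Residual

namespace Summit.BirchSwinnertonDyer.BirchSwinnertonDyer.Theorems.ShaCountTwo

section CMPrime

variable (W : WeierstrassCurve ℚ) [W.IsElliptic]

/-- On `CMInert W 2` the CM discriminant is `d_F ∈ {−3, −11, −19, −43, −67, −163}`, so `ℓ = |d_F|`
is a PRIME with `ℓ ≡ 3 (mod 4)` and `d_F = −ℓ`. [cite: SilvermanATAEC1994, App. A §3 (table of CM j-invariants)] -/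
theorem prime_natAbs_cmFieldDiscr_of_cmInert_two (hin : CMInert W 2) :
    (cmFieldDiscrOfJ W.j).natAbs.Prime ∧ (cmFieldDiscrOfJ W.j).natAbs % 4 = 3 ∧
      cmFieldDiscrOfJ W.j = -((cmFieldDiscrOfJ W.j).natAbs : ℤ) := by
  rcases cmFieldDiscrOfJ_mem_of_cmInert_two W hin with hd | hd | hd | hd | hd | hd <;> rw [hd] <;>
    norm_num

/-- **The CM prime divides the minimal discriminant** on H₂: `Δ_min = d_F · s²` (`s ∈ ℚ`,
`exists_Δ_eq_cmFieldDiscr_mul_sq_of_cmInert_two`) with `d_F = −ℓ` squarefree, so `s ∈ ℤ_{(ℓ)}` and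
`ℓ ∣ Δ_min`. [cite: SilvermanATAEC1994, App. A §3 (table of CM j-invariants)] -/
theorem natAbs_cmFieldDiscr_dvd_minimalDiscriminantInt [W.IsGloballyMinimal] (hCM : W.HasCM)
    (hin : CMInert W 2) (hsurj : W.HasSurjectiveModNGaloisRep 2) :
    ((cmFieldDiscrOfJ W.j).natAbs : ℤ) ∣ minimalDiscriminantInt W := by
  obtain ⟨hℓP, -, hdℓ⟩ := prime_natAbs_cmFieldDiscr_of_cmInert_two W hin
  obtain ⟨-, s, hs⟩ :=
    KolyvaginFrobeniusTwo.exists_Δ_eq_cmFieldDiscr_mul_sq_of_cmInert_two W hCM hin hsurj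
  set d : ℤ := cmFieldDiscrOfJ W.j with hd_def
  set ℓ : ℕ := d.natAbs with hℓ_def
  have hℓ' : Prime (ℓ : ℤ) := Nat.prime_iff_prime_int.mp hℓP
  set Δm : ℤ := minimalDiscriminantInt W with hΔm_def
  have hcast : (Δm : ℚ) = W.Δ := cast_minimalDiscriminantInt W
  have hsq : (Δm : ℚ) * (s.den : ℚ) ^ 2 = (d : ℚ) * (s.num : ℚ) ^ 2 := by
    have h1 : (s.num : ℚ) = s * s.den := (Rat.mul_den_eq_num s).symm
    rw [hcast, hs, h1]
    ring
  have hZ : Δm * (s.den : ℤ) ^ 2 = d * s.num ^ 2 := by exact_mod_cast hsq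
  have hℓd : (ℓ : ℤ) ∣ d := by rw [hdℓ]; exact Dvd.intro_left (-1) (by ring)
  -- `ℓ ∣ Δ_min · den²`
  have h1 : (ℓ : ℤ) ∣ Δm * (s.den : ℤ) ^ 2 := by rw [hZ]; exact Dvd.dvd.mul_right hℓd _
  rcases hℓ'.dvd_or_dvd h1 with h | h
  · exact h
  · -- `ℓ ∣ den`: then `ℓ² ∣ d · num²`, `ℓ ∥ d`, so `ℓ ∣ num`: contradiction with `gcd(num, den) = 1`
    exfalso
    have hℓden : (ℓ : ℤ) ∣ (s.den : ℤ) := hℓ'.dvd_of_dvd_pow h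
    have hℓ2 : (ℓ : ℤ) ^ 2 ∣ d * s.num ^ 2 := by rw [← hZ]; exact Dvd.dvd.mul_left (pow_dvd_pow_of_dvd hℓden 2) _
    -- `d = -ℓ`, so `ℓ² ∣ ℓ · num²` gives `ℓ ∣ num²`
    have hℓnum2 : (ℓ : ℤ) ∣ s.num ^ 2 := by
      have hℓ0 : (ℓ : ℤ) ≠ 0 := by exact_mod_cast hℓP.ne_zero
      have : (ℓ : ℤ) * ℓ ∣ (ℓ : ℤ) * (-(s.num ^ 2)) := by
        have h' : d * s.num ^ 2 = (ℓ : ℤ) * (-(s.num ^ 2)) := by rw [hdℓ]; ring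
        rw [← sq, ← h']; exact hℓ2
      have := (mul_dvd_mul_iff_left hℓ0).mp this
      exact (dvd_neg.mp this)
    have hℓnum : (ℓ : ℤ) ∣ s.num := hℓ'.dvd_of_dvd_pow hℓnum2
    have hqnum' : ℓ ∣ s.num.natAbs := Int.natCast_dvd.mp hℓnum
    have hqden' : ℓ ∣ s.den := by exact_mod_cast hℓden
    have hg : ℓ ∣ Nat.gcd s.num.natAbs s.den := Nat.dvd_gcd hqnum' hqden'
    rw [s.reduced.gcd_eq_one] at hg
    exact hℓP.one_lt.ne' (Nat.dvd_one.mp hg)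

/-- **The CM prime `ℓ = |d_F|` divides the conductor** of a curve on H₂ (`ℓ ∣ Δ_min`, so `W` is not
good at `ℓ`: `not_dvd_minimalDiscriminantInt_of_hasGoodReductionAtPrime'`,
`dvd_conductorNorm_iff_not_hasGoodReductionAtPrime`). [cite: SilvermanAEC2009, VII.5 Prop. 5.1(a)] -/
theorem natAbs_cmFieldDiscr_dvd_conductorNorm [W.IsGloballyMinimal] (hCM : W.HasCM)
    (hin : CMInert W 2) (hsurj : W.HasSurjectiveModNGaloisRep 2) :
    (cmFieldDiscrOfJ W.j).natAbs ∣ W.conductorNorm ℤ := by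
  obtain ⟨hℓP, -, -⟩ := prime_natAbs_cmFieldDiscr_of_cmInert_two W hin
  haveI : Fact (cmFieldDiscrOfJ W.j).natAbs.Prime := ⟨hℓP⟩
  rw [W.dvd_conductorNorm_iff_not_hasGoodReductionAtPrime]
  intro hgood
  exact not_dvd_minimalDiscriminantInt_of_hasGoodReductionAtPrime' W _ hgood
    (natAbs_cmFieldDiscr_dvd_minimalDiscriminantInt W hCM hin hsurj)

end CMPrime

/-! ## §2 `CMInert W |d_K|` for a prime Heegner field -/

/-- **The ramified prime of a prime Heegner field is inert in the CM field.** `W/ℚ` globally minimal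
with CM, `2` inert in `F`, `ρ̄_{E,2}` onto; `K` imaginary quadratic with `d_K` odd, `q = |d_K|`
prime, every prime of `N` split in `K`. Then `CMInert W q`: the CM prime `ℓ = |d_F| ∣ N` splits in
`K`, so `(d_K/ℓ) = 1` (decomposition law) and `q ≠ ℓ` (`q ∣ d_K`); were `d_F = −ℓ` a square mod `q`,
then with `d_K = −q` and `q ≡ ℓ ≡ 3 (mod 4)`: `(ℓ/q) = −1 = (q/ℓ)`, against
`(ℓ/q) = −(q/ℓ)`. [cite: GrossLMS1991, §2 (Heegner hypothesis)] -/
theorem cmInert_natAbs_discr_of_heegner (W : WeierstrassCurve ℚ) [W.IsElliptic] [W.IsGloballyMinimal]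
    (hCM : W.HasCM) (hin : CMInert W 2) (hsurj : W.HasSurjectiveModNGaloisRep 2)
    (K : Type) [Field K] [NumberField K] (hK : IsImaginaryQuadratic K)
    (hodd : Odd (NumberField.discr K)) (hH : SatisfiesHeegnerHypothesis (W.conductorNorm ℤ) K)
    (hq : (NumberField.discr K).natAbs.Prime) : CMInert W (NumberField.discr K).natAbs := by
  obtain ⟨hℓP, hℓ4, hdℓ⟩ := prime_natAbs_cmFieldDiscr_of_cmInert_two W hin
  set d : ℤ := cmFieldDiscrOfJ W.j with hd_def
  set ℓ : ℕ := d.natAbs with hℓ_def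
  set q : ℕ := (NumberField.discr K).natAbs with hq_def
  haveI : Fact ℓ.Prime := ⟨hℓP⟩
  haveI : Fact q.Prime := ⟨hq⟩
  have hq4 : q % 4 = 3 := natAbs_discr_mod_four K hK hodd
  have hDq : NumberField.discr K = -(q : ℤ) := discr_eq_neg_natAbs K hK
  have hℓ2 : ℓ ≠ 2 := by omega
  have hq2 : q ≠ 2 := by omega
  -- `ℓ ∣ N`, so `ℓ` splits in `K`: `(d_K/ℓ) = 1`
  have hℓN : ℓ ∣ W.conductorNorm ℤ := natAbs_cmFieldDiscr_dvd_conductorNorm W hCM hin hsurj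
  have hleg : legendreSym ℓ (NumberField.discr K) = 1 :=
    (Quadratic.ncard_primesOver_eq_two_iff_legendreSym hK.1 hℓ2).mp (hH ℓ hℓP hℓN)
  -- `q ≠ ℓ`
  have hqℓ : q ≠ ℓ := by
    intro h
    have h0 : legendreSym ℓ (NumberField.discr K) = 0 := by
      rw [legendreSym.eq_zero_iff, hDq, h]
      simp
    rw [h0] at hleg
    exact zero_ne_one hleg
  refine ⟨?_, ?_⟩
  · -- `¬ CMRamified`: `q ∤ d_F = -ℓ`
    intro hram
    have h1 : (q : ℤ) ∣ (ℓ : ℤ) := by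
      have : (q : ℤ) ∣ d := hram
      rw [hdℓ] at this
      exact dvd_neg.mp this
    have h2 : q ∣ ℓ := Int.natCast_dvd_natCast.mp h1
    exact hqℓ (((Nat.prime_dvd_prime_iff_eq hq hℓP).mp h2))
  · -- `¬ CMSplit`: `d_F` is not a square mod `q`
    rintro ⟨-, hsq⟩
    rw [if_neg hq2] at hsq
    have hd0 : ((d : ℤ) : ZMod q) ≠ 0 := by
      rw [Ne, ZMod.intCast_zmod_eq_zero_iff_dvd, hdℓ, dvd_neg, Int.natCast_dvd_natCast]
      intro h
      exact hqℓ ((Nat.prime_dvd_prime_iff_eq hq hℓP).mp h)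
    have hlegq : legendreSym q d = 1 := (legendreSym.eq_one_iff q hd0).mpr hsq
    -- `(ℓ/q) = -1`
    have hχq : legendreSym q (-1) = -1 := by
      rw [legendreSym.at_neg_one hq2, ZMod.χ₄_nat_three_mod_four hq4]
    have hχℓ : legendreSym ℓ (-1) = -1 := by
      rw [legendreSym.at_neg_one hℓ2, ZMod.χ₄_nat_three_mod_four hℓ4]
    have h1 : legendreSym q ℓ = -1 := by
      have : legendreSym q d = legendreSym q (-1) * legendreSym q ℓ := by
        rw [← legendreSym.mul, hdℓ]; ring_nf
      rw [hlegq, hχq] at this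
      linarith
    -- `(q/ℓ) = -1`
    have h2 : legendreSym ℓ q = -1 := by
      have : legendreSym ℓ (NumberField.discr K) = legendreSym ℓ (-1) * legendreSym ℓ q := by
        rw [← legendreSym.mul, hDq]; ring_nf
      rw [hleg, hχℓ] at this
      linarith
    -- reciprocity for `q ≡ ℓ ≡ 3 (mod 4)`: `(ℓ/q) = -(q/ℓ)`
    have hrec := legendreSym.quadratic_reciprocity_three_mod_four hℓ4 hq4
    rw [h1, h2] at hrec
    norm_num at hrec

/-! ## §3 The count identity on H₂, prime Heegner field, all habitat binders discharged -/

/-- **THE COUNT IDENTITY ON H₂ FOR A PRIME HEEGNER FIELD** (modulo Milne, total rank one and the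
finiteness of `Ш(E/ℚ)`, `Ш(E^{(d_K)}/ℚ)`). `W/ℚ` globally minimal with CM, `2` inert in `F`,
`ρ̄_{E,2}` onto; `K` imaginary quadratic with `d_K` odd, `|d_K|` PRIME, satisfying the Heegner
hypothesis for the conductor of `W`; `Wd = Cd • W^{(d_K)}` globally minimal with `|u(Cd)| = 1`
(exists: `exists_isGloballyMinimal_twist_of_prime_discr`); `rank E(ℚ) + rank Wd(ℚ) = 1`; `Ш(E/ℚ)`,
`Ш(Wd/ℚ)` finite. THEN `Ш(E_K)` is finite and **`#Ш(E_K)[2^∞] = #Ш(E/ℚ)[2^∞] · #Ш(Wd/ℚ)[2^∞]`**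
— file V with `CMInert W |d_K|` supplied by `cmInert_natAbs_discr_of_heegner`.
[cite: Milne1972ArithmeticAV, §1 Thm. 1 and §2 (through DokchitserDokchitserAnnals2010, §2.1, proof of Thm. 2.3)]
[cite: Kramer1981, Prop. 3] [cite: GrossLMS1991, §2] -/
theorem card_primaryComponent_sha_two_baseChange_eq_mul_of_heegner_prime_of_milne
    (hMilneC : Milne1972.bsdQuotient_baseChange_quadratic_anyModel)
    (W : WeierstrassCurve ℚ) [W.IsElliptic] [W.IsGloballyMinimal]
    (hCM : W.HasCM) (hin : CMInert W 2) (hsurj : W.HasSurjectiveModNGaloisRep 2)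
    (K : Type) [Field K] [NumberField K] (hK : IsImaginaryQuadratic K)
    (hodd : Odd (NumberField.discr K)) (hH : SatisfiesHeegnerHypothesis (W.conductorNorm ℤ) K)
    (hq : (NumberField.discr K).natAbs.Prime)
    (Wd : WeierstrassCurve ℚ) [Wd.IsElliptic] [Wd.IsGloballyMinimal] (Cd : VariableChange ℚ)
    (hWd : Cd • W.quadraticTwist (NumberField.discr K : ℚ) = Wd) (hu : |(Cd.u : ℚ)| = 1)
    (hr : W.mordellWeilRank + Wd.mordellWeilRank = 1) [Finite W.sha] [Finite Wd.sha] :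
    Finite (W.baseChange K).sha ∧
      Nat.card (AddCommGroup.primaryComponent (W.baseChange K).sha 2) =
        Nat.card (AddCommGroup.primaryComponent W.sha 2) *
          Nat.card (AddCommGroup.primaryComponent Wd.sha 2) :=
  card_primaryComponent_sha_two_baseChange_eq_mul_of_cmInert_of_milne hMilneC W hCM hin hsurj K hK hodd hH
    hq (cmInert_natAbs_discr_of_heegner W hCM hin hsurj K hK hodd hH hq) Wd Cd hWd hu hr

end Summit.BirchSwinnertonDyer.BirchSwinnertonDyer.Theorems.ShaCountTwo

end
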